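import Summits.AnomalousDissipation.AnomalousDissipation.Theorems.SawtoothPulseCascadeK1LocalisedCascadeKHSheetPropagator
import Summits.AnomalousDissipation.AnomalousDissipation.Theorems.SawtoothPulseCascadeK1LocalisedCascadeKHSheetTraceBound

/-!
# K2 lane (route-2 `SawtoothPulseCascade`, crux dir `K1LocalisedCascade`): S2 (homogeneous sheet block) REDUCED TO A SCALAR TABLE

Helper file of the K2 lane (S2 `KHSheetAbsolute γ B` of planner p4's `K2ControlSketch.lean`; ACL item stmt-AnomalousDissipation-19491).
`sheet_energy_le_of_trace_table`: for `k > 0`, `β`, the sheet block `F = khField k β` (written out, named by `hF`) and a constant `B`, IF the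
explicit scalar `2τ(k,β,θ) = 2(C(θ)² + Sn(θ)²·k²·W(k,β))` is `≤ B²` for all `θ ∈ [0,γ]` — with `(C,Sn) = (cosh σθ, sinh σθ/σ)`, `σ = sawSigma k β`,
when `c²(k,β) < 0`; `(cos ωθ, sin ωθ/ω)`, `ω = k√c²`, when `c² > 0`; `(1, θ)` when `c² = 0`; `W = (Am + E|S|²)/(m² − |S|²)`, `A = mp² + 4|S|²(p+m)`,
`E = p² + 4mp + 4|S|²`, `m = −Σ₀`, `p = π/2 − 2m` — THEN every solution `q` of `q′ = F q` on `[0,γ]` in the S2-stub sense satisfies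
`khForm k β (q θ) ≤ B² · khForm k β (q 0)` for all `θ ∈ [0,γ]`. Ingredients: `sheet_solution_eq` (explicit propagator + Lipschitz uniqueness),
`khForm_propagated_le_trace` (unit-determinant pencil trace bound), `khGram_ge` (energy ≥ 0). So the homogeneous S2 constant of the line is
`B(γ)² = sup_{k,β,θ≤γ} 2τ` — a certified-numerics task with no ODE left (memo `Cruxes/K1LocalisedCascade/K2SheetBlockPropagator.md`).
No definitions; no statement about the crux. [cite: Drazin2002, §8.3 (8.36)–(8.38) (Rayleigh jump conditions at the kinks of a broken-line profile)] [problem: turb]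
-/

-- `Summit.<Summit>.<Problem>`: single-conjunct summit, the duplicate namespace segment is deliberate.
set_option linter.dupNamespace false

noncomputable section

namespace Summit.AnomalousDissipation.AnomalousDissipation.Theorems.SawtoothPulseCascade.K2PhaseBudget

open Set Real Complex Literature.Analysis.FluidPDE.SawtoothCascade

/-- The propagator pair of the unstable regime: `(cosh σθ, sinh σθ/σ)` with `σ² = −k²c²`, `σ ≠ 0`. [folklore] -/
theorem propagatorPair_cosh {k β σ : ℝ} (hσ : σ ^ 2 = -(k ^ 2 * sawC2 k β)) (hσ0 : σ ≠ 0) :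
    (∀ θ, HasDerivAt (fun t => Real.cosh (σ * t)) (-(k ^ 2 * sawC2 k β) * (Real.sinh (σ * θ) / σ)) θ) ∧
    (∀ θ, HasDerivAt (fun t => Real.sinh (σ * t) / σ) (Real.cosh (σ * θ)) θ) ∧
    Real.cosh (σ * 0) = 1 ∧ Real.sinh (σ * 0) / σ = 0 ∧
    ∀ θ, Real.cosh (σ * θ) ^ 2 + (Real.sinh (σ * θ) / σ) ^ 2 * k ^ 2 * sawC2 k β = 1 := by
  refine ⟨fun θ => ?_, fun θ => ?_, by simp, by simp, fun θ => ?_⟩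
  · have h := (Real.hasDerivAt_cosh (σ * θ)).comp θ ((hasDerivAt_id θ).const_mul σ)
    have e : Real.sinh (σ * θ) * (σ * 1) = -(k ^ 2 * sawC2 k β) * (Real.sinh (σ * θ) / σ) := by
      rw [← hσ]; field_simp
    exact h.congr_deriv e
  · have h := ((Real.hasDerivAt_sinh (σ * θ)).comp θ ((hasDerivAt_id θ).const_mul σ)).div_const σ
    have e : Real.cosh (σ * θ) * (σ * 1) / σ = Real.cosh (σ * θ) := by field_simp
    exact h.congr_deriv e
  · have hc : k ^ 2 * sawC2 k β = -σ ^ 2 := by rw [hσ]; ring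
    rw [mul_assoc, hc, div_pow]
    field_simp
    nlinarith [Real.cosh_sq (σ * θ)]

/-- The propagator pair of the stable regime: `(cos ωθ, sin ωθ/ω)` with `ω² = k²c²`, `ω ≠ 0`. [folklore] -/
theorem propagatorPair_cos {k β ω : ℝ} (hω : ω ^ 2 = k ^ 2 * sawC2 k β) (hω0 : ω ≠ 0) :
    (∀ θ, HasDerivAt (fun t => Real.cos (ω * t)) (-(k ^ 2 * sawC2 k β) * (Real.sin (ω * θ) / ω)) θ) ∧
    (∀ θ, HasDerivAt (fun t => Real.sin (ω * t) / ω) (Real.cos (ω * θ)) θ) ∧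
    Real.cos (ω * 0) = 1 ∧ Real.sin (ω * 0) / ω = 0 ∧
    ∀ θ, Real.cos (ω * θ) ^ 2 + (Real.sin (ω * θ) / ω) ^ 2 * k ^ 2 * sawC2 k β = 1 := by
  refine ⟨fun θ => ?_, fun θ => ?_, by simp, by simp, fun θ => ?_⟩
  · have h := (Real.hasDerivAt_cos (ω * θ)).comp θ ((hasDerivAt_id θ).const_mul ω)
    have e : -Real.sin (ω * θ) * (ω * 1) = -(k ^ 2 * sawC2 k β) * (Real.sin (ω * θ) / ω) := by
      rw [← hω]; field_simp
    exact h.congr_deriv e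
  · have h := ((Real.hasDerivAt_sin (ω * θ)).comp θ ((hasDerivAt_id θ).const_mul ω)).div_const ω
    have e : Real.cos (ω * θ) * (ω * 1) / ω = Real.cos (ω * θ) := by field_simp
    exact h.congr_deriv e
  · rw [mul_assoc, ← hω, div_pow]
    field_simp
    nlinarith [Real.sin_sq_add_cos_sq (ω * θ)]

/-- The propagator pair of the neutral regime: `(1, θ)` when `c² = 0`. [folklore] -/
theorem propagatorPair_one {k β : ℝ} (h0 : sawC2 k β = 0) :
    (∀ θ : ℝ, HasDerivAt (fun _ : ℝ => (1 : ℝ)) (-(k ^ 2 * sawC2 k β) * θ) θ) ∧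
    (∀ θ : ℝ, HasDerivAt (fun t : ℝ => t) (1 : ℝ) θ) ∧
    ∀ θ : ℝ, (1 : ℝ) ^ 2 + θ ^ 2 * k ^ 2 * sawC2 k β = 1 := by
  refine ⟨fun θ => ?_, fun θ => hasDerivAt_id θ, fun θ => ?_⟩
  · rw [h0]; simpa using hasDerivAt_const θ (1 : ℝ)
  · rw [h0]; ring

/-- **S2 (homogeneous) reduced to a scalar table.** Let `k > 0`, `F = khField k β` (written out), `m = −Σ₀`, `S = S_β(k)`, and write
`2τ(C, Sn) := 2(C² + Sn²k²(Am + E|S|²)/(m² − |S|²))`. If `2τ ≤ B²` along the propagator pair of the line's regime for all `θ ∈ [0,γ]`, then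
every solution of the sheet block on `[0,γ]` obeys `khForm(q θ) ≤ B²·khForm(q 0)`. [cite: Drazin2002, §8.3 (8.36)–(8.38)] -/
theorem sheet_energy_le_of_trace_table {k β γ B : ℝ} (hk : 0 < k) {p S : ℂ} {m : ℝ} {F : (Fin 2 → ℂ) → (Fin 2 → ℂ)}
    (hp : p = ((π / 2 + 2 * sawSigma0 k β : ℝ) : ℂ)) (hS : S = sawS k β) (hm : m = -sawSigma0 k β)
    (hF : F = fun v => ![I * k * (-p * v 0 - 2 * S * v 1), I * k * (2 * (starRingEnd ℂ) S * v 0 + p * v 1)])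
    (htable : ∀ θ ∈ Icc (0 : ℝ) γ, ∀ C Sn : ℝ,
      ((sawC2 k β < 0 ∧ C = Real.cosh (sawSigma k β * θ) ∧ Sn = Real.sinh (sawSigma k β * θ) / sawSigma k β) ∨
        (0 < sawC2 k β ∧ C = Real.cos (k * Real.sqrt (sawC2 k β) * θ) ∧
          Sn = Real.sin (k * Real.sqrt (sawC2 k β) * θ) / (k * Real.sqrt (sawC2 k β))) ∨
        (sawC2 k β = 0 ∧ C = 1 ∧ Sn = θ)) →
      2 * (C ^ 2 + Sn ^ 2 * k ^ 2 *
          (((m * (π / 2 - 2 * m) ^ 2 + 4 * Complex.normSq S * ((π / 2 - 2 * m) + m)) * m +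
            ((π / 2 - 2 * m) ^ 2 + 4 * m * (π / 2 - 2 * m) + 4 * Complex.normSq S) * Complex.normSq S) /
            (m ^ 2 - Complex.normSq S))) ≤ B ^ 2)
    {q : ℝ → (Fin 2 → ℂ)} (hq : ∀ θ ∈ Icc (0 : ℝ) γ, HasDerivWithinAt q (F (q θ)) (Icc (0 : ℝ) γ) θ) :
    ∀ θ ∈ Icc (0 : ℝ) γ,
      m * (Complex.normSq (q θ 0) + Complex.normSq (q θ 1)) - 2 * ((starRingEnd ℂ) (q θ 0) * S * q θ 1).re ≤
        B ^ 2 * (m * (Complex.normSq (q 0 0) + Complex.normSq (q 0 1)) - 2 * ((starRingEnd ℂ) (q 0 0) * S * q 0 1).re) := by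
  intro θ hθ
  -- energy of the datum is nonnegative
  have hE0 : 0 ≤ m * (Complex.normSq (q 0 0) + Complex.normSq (q 0 1)) - 2 * ((starRingEnd ℂ) (q 0 0) * S * q 0 1).re := by
    obtain ⟨h1, h2⟩ := khGram_ge hk β (q 0 0) (q 0 1)
    rw [hm, hS]
    exact le_trans (mul_nonneg h1.le (add_nonneg (Complex.normSq_nonneg _) (Complex.normSq_nonneg _))) h2
  -- generic step: given a propagator pair with the ODE/initial/determinant properties, conclude
  have step : ∀ C Sn : ℝ → ℝ, (∀ t, HasDerivAt C (-(k ^ 2 * sawC2 k β) * Sn t) t) → (∀ t, HasDerivAt Sn (C t) t) →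
      C 0 = 1 → Sn 0 = 0 → (C θ) ^ 2 + (Sn θ) ^ 2 * k ^ 2 * sawC2 k β = 1 →
      2 * ((C θ) ^ 2 + (Sn θ) ^ 2 * k ^ 2 *
          (((m * (π / 2 - 2 * m) ^ 2 + 4 * Complex.normSq S * ((π / 2 - 2 * m) + m)) * m +
            ((π / 2 - 2 * m) ^ 2 + 4 * m * (π / 2 - 2 * m) + 4 * Complex.normSq S) * Complex.normSq S) /
            (m ^ 2 - Complex.normSq S))) ≤ B ^ 2 →
      m * (Complex.normSq (q θ 0) + Complex.normSq (q θ 1)) - 2 * ((starRingEnd ℂ) (q θ 0) * S * q θ 1).re ≤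
        B ^ 2 * (m * (Complex.normSq (q 0 0) + Complex.normSq (q 0 1)) - 2 * ((starRingEnd ℂ) (q 0 0) * S * q 0 1).re) := by
    intro C Sn hC hSn hC0 hSn0 hdet htab
    have hsol := sheet_solution_eq (γ := γ) hp hS hF hC hSn hC0 hSn0 hq θ hθ
    have hdet' : (C θ) ^ 2 + (Sn θ) ^ 2 * k ^ 2 * sawC2 k β = 1 := hdet
    have htr := khForm_propagated_le_trace hk β hp hS hm (C θ) (Sn θ) hdet' (q 0 0) (q 0 1)
    have h0 : q θ 0 = (C θ : ℂ) * q 0 0 + (Sn θ : ℂ) * (I * k * (-p * q 0 0 - 2 * S * q 0 1)) := by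
      rw [hsol, hF]; simp
    have h1 : q θ 1 = (C θ : ℂ) * q 0 1 + (Sn θ : ℂ) * (I * k * (2 * (starRingEnd ℂ) S * q 0 0 + p * q 0 1)) := by
      rw [hsol, hF]; simp
    rw [h0, h1]
    exact htr.trans (mul_le_mul_of_nonneg_right htab hE0)
  rcases lt_trichotomy (sawC2 k β) 0 with hneg | hzero | hpos
  · -- unstable: σ = sawSigma k β > 0, σ² = −k²c²
    have hσ2 : sawSigma k β ^ 2 = -(k ^ 2 * sawC2 k β) := by
      unfold sawSigma
      rw [mul_pow, Real.sq_sqrt (le_max_left _ _), max_eq_right (by linarith)]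
      ring
    have hσ0 : sawSigma k β ≠ 0 := by
      intro h
      rw [h] at hσ2
      nlinarith [mul_pos (pow_pos hk 2) (neg_pos.2 hneg)]
    obtain ⟨hC, hSn, hC0, hSn0, hdet⟩ := propagatorPair_cosh hσ2 hσ0
    exact step _ _ hC hSn hC0 hSn0 (hdet θ) (htable θ hθ _ _ (Or.inl ⟨hneg, rfl, rfl⟩))
  · -- neutral
    obtain ⟨hC, hSn, hdet⟩ := propagatorPair_one (k := k) hzero
    exact step (fun _ => 1) (fun t => t) hC hSn rfl rfl (hdet θ) (htable θ hθ _ _ (Or.inr (Or.inr ⟨hzero, rfl, rfl⟩)))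
  · -- stable: ω = k √c²
    have hω2 : (k * Real.sqrt (sawC2 k β)) ^ 2 = k ^ 2 * sawC2 k β := by
      rw [mul_pow, Real.sq_sqrt hpos.le]
    have hω0 : k * Real.sqrt (sawC2 k β) ≠ 0 :=
      mul_ne_zero hk.ne' (Real.sqrt_ne_zero'.2 hpos)
    obtain ⟨hC, hSn, hC0, hSn0, hdet⟩ := propagatorPair_cos hω2 hω0
    exact step _ _ hC hSn hC0 hSn0 (hdet θ) (htable θ hθ _ _ (Or.inr (Or.inl ⟨hpos, rfl, rfl⟩)))

end Summit.AnomalousDissipation.AnomalousDissipation.Theorems.SawtoothPulseCascade.K2PhaseBudget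

end
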